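import Summits.ValiantsHypothesis.ValiantsHypothesis.Theorems.BarrierLeverChowBenchmarkPairsBlockPeelCertPack
import Mathlib.Algebra.Polynomial.Coeff

/-!
# Route BarrierLever — item 22038 `ChowBenchmarkPairs`, line `moore-peel`: the BLOCK PEEL — the FAST data-free certificate kit, II:
# power tables for the attached rows and the POLYNOMIAL evaluation of the internal pair rows

Helper file (`--supports stmt-ValiantsHypothesis-22038`; cell valiant-natproofs, rung V4, 𝒟-side benchmark of record, line `moore_peel`,
planner SUCCESSOR MANDATE M2 (HOME/STATUS.md l.1824); seat val-np-p4 gen 30).  Closes NO item; no certificate is checked here.  Fourth kit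
(after `…CertLU`, `…CertLUP`, `…CertPack`, p716120 / p716688 / p718789): with packed rows the LU and the check cost seconds, and the
TABULATION of the block matrix becomes the bottleneck (`…CertPack.fastTable`: ≈ 150 µs per attached entry through `powModBin`, and the
Mathlib `pairCoef` sums over `2^{popcount B}` subsets — minutes for windows straddling a power of two).  This file removes both:

* `powTab y p m` — the table of `y^e mod p`, `e < m` (kernel `natCast_powTab_getD`); `fastAttTab` — the attached entry
  `[q &&& B = q] · κ(popcount B - popcount q) · powTab[B - q]` (kernel `natCast_fastAttTab`);
* `fastPair κ p y y' B` — the internal pair entry by the POLYNOMIAL identity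
  `pairCoef κ y y' B = Σ_k κ(m-k) κ(k) [z^k] ∏_{c ∈ bits B} (y^{2^c} + y'^{2^c} z)` (`m = popcount B`), i.e. `O(m²)` operations instead of
  `2^m`: `pairPoly` (coefficient arrays mod `p`, `polyMulLin`), `pairSum`; KERNEL: `natCast_pairPoly_getD` (the arrays are the coefficients
  of `pairQ`, by `Polynomial.coeff_X_mul` …), `coeff_pairQ` (`Finset.prod_add` + `coeff_C_mul_X_pow`), `pairCoef_eq_sum_card`, whence
  **`natCast_fastPair`**;
* `fastTable3` (canonical window order `canonEquiv`; power tables, popcounts, row points/labels computed ONCE — an entry is a few table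
  reads) + **`flatMat_fastTable3`** (the table IS the reindexed block matrix) and **`det_blockMatrix_X_ne_zero_of_packCheckP3`**
  (symbolic `det J^κ(i,t)(Λ) ≠ 0` from `packCheckP (fastTable3 …) …`, through `det_ne_zero_of_packCheckP` of `…CertPack`).

WHAT THIS IS NOT: nothing is certified in this file; node #1 `stub_segmentMeanValue` (∀ h) untouched; nothing on crux
stmt-ValiantsHypothesis-14610 or on `VP` versus `VNP`.
-/

set_option linter.dupNamespace false

namespace Summit.ValiantsHypothesis.ValiantsHypothesis.Theorems.BarrierLever.MoorePeel

open Finset Polynomial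

/-! ## 1. Power tables and attached entries -/

/-- The table `e ↦ y^e mod p`, `e < m`. -/
def powTab (y p m : ℕ) : Array ℕ := Array.ofFn fun e : Fin m => powModBin y p e.val

/-- KERNEL: reading the power table. -/
theorem natCast_powTab_getD (y p m e : ℕ) (he : e < m) : (((powTab y p m).getD e 0 : ℕ) : ZMod p) = (y : ZMod p) ^ e := by
  rw [powTab, Array.getD_eq_getD_getElem?, Array.getElem?_ofFn, dif_pos he, Option.getD_some, natCast_powModBin]

/-- The attached entry `[T_q ⊆ T_B] · κ(|B|-|q|) · y^{B-q}` from a power table. -/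
def fastAttTab (κ : ℕ → ℕ) (p : ℕ) (ptab : Array ℕ) (q B : ℕ) : ℕ :=
  if q &&& B = q then κ (popcount B - popcount q) % p * ptab.getD (B - q) 0 % p else 0

/-- KERNEL: the tabled attached entry is the block entry (`B < m`). -/
theorem natCast_fastAttTab (κ : ℕ → ℕ) (p y m q B : ℕ) (hB : B < m) :
    ((fastAttTab κ p (powTab y p m) q B : ℕ) : ZMod p) = ((kincl κ q B : ℕ) : ZMod p) * (y : ZMod p) ^ (B - q) := by
  unfold fastAttTab kincl
  by_cases hsub : bits q ⊆ bits B
  · rw [if_pos (bits_subset_bits_iff.mp hsub), if_pos hsub, card_bits, card_bits, ZMod.natCast_mod, Nat.cast_mul,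
      ZMod.natCast_mod, natCast_powTab_getD y p m (B - q) (by omega)]
  · rw [if_neg (fun h => hsub (bits_subset_bits_iff.mpr h)), if_neg hsub, Nat.cast_zero, zero_mul]

/-! ## 2. Internal pair rows by the polynomial method -/

/-- Multiply a coefficient array by `(a + b z)` modulo `p`. -/
def polyMulLin (cs : Array ℕ) (a b p : ℕ) : Array ℕ :=
  Array.ofFn fun k : Fin (cs.size + 1) =>
    (a * cs.getD k.val 0 + b * (if k.val = 0 then 0 else cs.getD (k.val - 1) 0)) % p

/-- The coefficients mod `p` of `∏_{c ∈ l} (y^{2^c} + y'^{2^c} z)`. -/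
def pairPoly (y y' p : ℕ) : List ℕ → Array ℕ
  | [] => Array.ofFn fun _ : Fin 1 => 1 % p
  | c :: l => polyMulLin (pairPoly y y' p l) (powModBin y p (2 ^ c)) (powModBin y' p (2 ^ c)) p

/-- `Σ_{k < f} κ(m-k) κ(k) cs[k]` modulo `p` (accumulator). -/
def pairSum (κ : ℕ → ℕ) (p m : ℕ) (cs : Array ℕ) : ℕ → ℕ → ℕ
  | 0, acc => acc
  | k + 1, acc => pairSum κ p m cs k ((acc + κ (m - k) % p * (κ k % p) % p * cs.getD k 0) % p)

/-- **The fast internal pair entry** `Σ_k κ(m-k) κ(k) [z^k] ∏_{c ∈ bits B} (y^{2^c} + y'^{2^c} z)`, `m = popcount B`. -/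
def fastPair (κ : ℕ → ℕ) (p y y' B : ℕ) : ℕ :=
  pairSum κ p (Nat.bitIndices B).length (pairPoly y y' p (Nat.bitIndices B)) ((Nat.bitIndices B).length + 1) 0

section PairKernel

variable (p : ℕ)

/-- The polynomial `∏_{c ∈ l} (a_c + b_c X)` (spec of `pairPoly`). -/
noncomputable def pairQ (a b : ℕ → ZMod p) : List ℕ → (ZMod p)[X]
  | [] => 1
  | c :: l => (Polynomial.C (a c) + Polynomial.C (b c) * Polynomial.X) * pairQ a b l

/-- Out-of-range reads of an array are the default. -/
theorem getD_of_size_le (cs : Array ℕ) (k : ℕ) (hk : cs.size ≤ k) : cs.getD k 0 = 0 := by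
  rw [Array.getD_eq_getD_getElem?, Array.getElem?_eq_none hk]
  rfl

/-- KERNEL: `polyMulLin` multiplies the represented polynomial by `C a + C b * X`. -/
theorem natCast_polyMulLin_getD (cs : Array ℕ) (a b : ℕ) (Q : (ZMod p)[X])
    (hQ : ∀ k, ((cs.getD k 0 : ℕ) : ZMod p) = Q.coeff k) (k : ℕ) :
    (((polyMulLin cs a b p).getD k 0 : ℕ) : ZMod p) =
      ((Polynomial.C (a : ZMod p) + Polynomial.C (b : ZMod p) * Polynomial.X) * Q).coeff k := by
  have hexp : ((Polynomial.C (a : ZMod p) + Polynomial.C (b : ZMod p) * Polynomial.X) * Q).coeff k =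
      (a : ZMod p) * Q.coeff k + (b : ZMod p) * (if k = 0 then 0 else Q.coeff (k - 1)) := by
    rw [add_mul, Polynomial.coeff_add, Polynomial.coeff_C_mul, mul_assoc, Polynomial.coeff_C_mul]
    congr 2
    rcases k with _ | k
    · rw [if_pos rfl, Polynomial.coeff_X_mul_zero]
    · rw [if_neg (Nat.succ_ne_zero k), Polynomial.coeff_X_mul, Nat.add_sub_cancel]
  rw [hexp]
  by_cases hk : k < cs.size + 1
  · rw [polyMulLin, Array.getD_eq_getD_getElem?, Array.getElem?_ofFn, dif_pos hk, Option.getD_some]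
    simp only
    rw [ZMod.natCast_mod, Nat.cast_add, Nat.cast_mul, Nat.cast_mul, hQ k]
    congr 2
    split_ifs with h0
    · rw [Nat.cast_zero]
    · rw [hQ (k - 1)]
  · have h1 : (polyMulLin cs a b p).getD k 0 = 0 :=
      getD_of_size_le _ k (by rw [polyMulLin, Array.size_ofFn]; omega)
    have h2 : cs.getD k 0 = 0 := getD_of_size_le cs k (by omega)
    have h3 : cs.getD (k - 1) 0 = 0 := getD_of_size_le cs (k - 1) (by omega)
    rw [h1, Nat.cast_zero, ← hQ k, h2, Nat.cast_zero, mul_zero, zero_add]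
    split_ifs with h0
    · rw [mul_zero]
    · rw [← hQ (k - 1), h3, Nat.cast_zero, mul_zero]

/-- KERNEL: `pairPoly` holds the coefficients of `pairQ` (with `a_c = y^{2^c}`, `b_c = y'^{2^c}`). -/
theorem natCast_pairPoly_getD (y y' : ℕ) : ∀ (l : List ℕ) (k : ℕ),
    (((pairPoly y y' p l).getD k 0 : ℕ) : ZMod p) =
      (pairQ p (fun c => (y : ZMod p) ^ 2 ^ c) (fun c => (y' : ZMod p) ^ 2 ^ c) l).coeff k
  | [], k => by
    rw [pairPoly, pairQ, Polynomial.coeff_one]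
    by_cases hk : k < 1
    · rw [Array.getD_eq_getD_getElem?, Array.getElem?_ofFn, dif_pos hk, Option.getD_some, ZMod.natCast_mod, Nat.cast_one,
        if_pos (by omega)]
    · rw [getD_of_size_le _ k (by rw [Array.size_ofFn]; omega), Nat.cast_zero, if_neg (by omega)]
  | c :: l, k => by
    rw [pairPoly, pairQ, natCast_polyMulLin_getD p _ _ _ _ (natCast_pairPoly_getD y y' l) k, natCast_powModBin, natCast_powModBin]

/-- KERNEL: `pairSum` in `ZMod p`. -/
theorem natCast_pairSum (κ : ℕ → ℕ) (m : ℕ) (cs : Array ℕ) (f acc : ℕ) :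
    ((pairSum κ p m cs f acc : ℕ) : ZMod p) =
      (acc : ZMod p) + ∑ k ∈ Finset.range f, ((κ (m - k) : ℕ) : ZMod p) * ((κ k : ℕ) : ZMod p) * ((cs.getD k 0 : ℕ) : ZMod p) := by
  induction f generalizing acc with
  | zero => simp [pairSum]
  | succ f ih =>
    rw [pairSum, ih, Finset.sum_range_succ]
    simp only [ZMod.natCast_mod, Nat.cast_add, Nat.cast_mul]
    ring

/-- `pairQ` over a duplicate-free list is the `Finset` product. -/
theorem pairQ_eq_prod (a b : ℕ → ZMod p) : ∀ (l : List ℕ), l.Nodup →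
    pairQ p a b l = ∏ c ∈ l.toFinset, (Polynomial.C (b c) * Polynomial.X + Polynomial.C (a c))
  | [], _ => by simp [pairQ]
  | c :: l, hl => by
    obtain ⟨hc, hl'⟩ := List.nodup_cons.mp hl
    rw [pairQ, List.toFinset_cons, Finset.prod_insert (fun h => hc (List.mem_toFinset.mp h)), pairQ_eq_prod a b l hl',
      add_comm]

/-- KERNEL: the coefficients of `pairQ` are the subset sums by cardinality. -/
theorem coeff_pairQ (a b : ℕ → ZMod p) (l : List ℕ) (hl : l.Nodup) (k : ℕ) :
    (pairQ p a b l).coeff k =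
      ∑ d ∈ l.toFinset.powerset, if d.card = k then (∏ c ∈ d, b c) * ∏ c ∈ l.toFinset \ d, a c else 0 := by
  rw [pairQ_eq_prod p a b l hl, Finset.prod_add, Polynomial.finsetSum_coeff]
  refine Finset.sum_congr rfl fun d _ => ?_
  have e1 : ∏ c ∈ d, Polynomial.C (b c) * Polynomial.X = Polynomial.C (∏ c ∈ d, b c) * Polynomial.X ^ d.card := by
    rw [Finset.prod_mul_distrib, map_prod, Finset.prod_const]
  have e2 : ∏ c ∈ l.toFinset \ d, Polynomial.C (a c) = Polynomial.C (∏ c ∈ l.toFinset \ d, a c) := by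
    rw [map_prod]
  rw [e1, e2, mul_comm, ← mul_assoc, ← map_mul, Polynomial.coeff_C_mul_X_pow]
  split_ifs with h1 h2 h2
  · rw [mul_comm]
  · exact absurd h1.symm h2
  · exact absurd h2.symm h1
  · rfl

/-- **The pair coefficient regrouped by the cardinality of `d`.** -/
theorem pairCoef_eq_sum_card (κ : ℕ → ℕ) (y y' : ZMod p) (B : ℕ) :
    pairCoef κ y y' B = ∑ k ∈ Finset.range ((bits B).card + 1), ((κ ((bits B).card - k) : ℕ) : ZMod p) * ((κ k : ℕ) : ZMod p) *
      ∑ d ∈ (bits B).powerset, if d.card = k then (∏ c ∈ d, y' ^ 2 ^ c) * ∏ c ∈ bits B \ d, y ^ 2 ^ c else 0 := by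
  unfold pairCoef
  -- push the outer sum inside and evaluate the `k`-sum at `k = |d|`
  simp_rw [Finset.mul_sum]
  rw [Finset.sum_comm]
  refine Finset.sum_congr rfl fun d hd => ?_
  have hdT : d ⊆ bits B := Finset.mem_powerset.mp hd
  have hcard : d.card < (bits B).card + 1 := Nat.lt_succ_of_le (Finset.card_le_card hdT)
  simp_rw [mul_ite, mul_zero]
  rw [Finset.sum_ite_eq (Finset.range ((bits B).card + 1)) d.card, if_pos (Finset.mem_range.mpr hcard),
    Finset.card_sdiff_of_subset hdT, bin, bin, ← Finset.prod_pow_eq_pow_sum, ← Finset.prod_pow_eq_pow_sum]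
  ring

/-- **KERNEL: the fast pair entry is the block matrix's internal pair coefficient.** -/
theorem natCast_fastPair (κ : ℕ → ℕ) (y y' B : ℕ) :
    ((fastPair κ p y y' B : ℕ) : ZMod p) = pairCoef κ (y : ZMod p) (y' : ZMod p) B := by
  rw [fastPair, natCast_pairSum, Nat.cast_zero, zero_add, pairCoef_eq_sum_card]
  have hlen : (Nat.bitIndices B).length = (bits B).card := (card_bits B).symm
  rw [hlen]
  refine Finset.sum_congr rfl fun k _ => ?_
  rw [natCast_pairPoly_getD, coeff_pairQ p _ _ _ Nat.bitIndices_nodup]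
  rfl

end PairKernel

/-- The codes of the multi-window are `< c_{i+t}`. -/
theorem windowStart_add_finSigmaFinEquiv_lt (i t : ℕ) (ρ' : BlockIdx i t) :
    windowStart i + (finSigmaFinEquiv ρ' : ℕ) < windowStart (i + t) := by
  rw [windowStart_add_blockWidth]
  have := finSigmaFinEquiv_lt_blockWidth ρ'
  omega

/-! ## 3. The fast table, II (canonical window order, all per-row / per-column data tabulated once) -/

/-- The attached entry from tables: `[q &&& B = q] · κ(popB - popq) · ptab[B - q]`. -/
def fastAtt3 (κ : ℕ → ℕ) (p : ℕ) (ptab : Array ℕ) (q popq B popB : ℕ) : ℕ :=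
  if q &&& B = q then κ (popB - popq) % p * ptab.getD (B - q) 0 % p else 0

/-- KERNEL: with the true popcounts and the power table, `fastAtt3` is the block entry (`B < m`). -/
theorem natCast_fastAtt3 (κ : ℕ → ℕ) (p y m q B : ℕ) (hB : B < m) :
    ((fastAtt3 κ p (powTab y p m) q (popcount q) B (popcount B) : ℕ) : ZMod p) =
      ((kincl κ q B : ℕ) : ZMod p) * (y : ZMod p) ^ (B - q) := by
  rw [← natCast_fastAttTab κ p y m q B hB]
  rfl

/-- The canonical window order `BlockIdx i t ≃ Fin n` (`n = blockWidth i t`). -/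
def canonEquiv (i t n : ℕ) (h : blockWidth i t = n) : BlockIdx i t ≃ Fin n := finSigmaFinEquiv.trans (finCongr h)

/-- In the canonical order, column `c` is the code `c_i + c`. -/
theorem finSigmaFinEquiv_canonEquiv_symm (i t n : ℕ) (h : blockWidth i t = n) (c : Fin n) :
    (finSigmaFinEquiv ((canonEquiv i t n h).symm c) : ℕ) = c := by
  rw [canonEquiv, Equiv.symm_trans_apply, Equiv.apply_symm_apply]
  rfl

/-- Per-row data in the canonical order: the point `s` of row `r`. -/
def rowPoint (i t n : ℕ) (h : blockWidth i t = n) : Array ℕ := Array.ofFn fun r : Fin n => (((canonEquiv i t n h).symm r).1 : ℕ)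

/-- Per-row data: the label `q` of row `r` (`q < i` attached row `T_q`; `q ≥ i` internal pair with point `q - i`). -/
def rowLabel (i t n : ℕ) (h : blockWidth i t = n) : Array ℕ := Array.ofFn fun r : Fin n => (((canonEquiv i t n h).symm r).2 : ℕ)

/-- KERNEL: reading the row-point table. -/
theorem rowPoint_getD (i t n : ℕ) (h : blockWidth i t = n) (r : Fin n) :
    (rowPoint i t n h).getD r.val 0 = (((canonEquiv i t n h).symm r).1 : ℕ) := by
  rw [rowPoint, Array.getD_eq_getD_getElem?, Array.getElem?_ofFn, dif_pos r.2, Option.getD_some]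

/-- KERNEL: reading the row-label table. -/
theorem rowLabel_getD (i t n : ℕ) (h : blockWidth i t = n) (r : Fin n) :
    (rowLabel i t n h).getD r.val 0 = (((canonEquiv i t n h).symm r).2 : ℕ) := by
  rw [rowLabel, Array.getD_eq_getD_getElem?, Array.getElem?_ofFn, dif_pos r.2, Option.getD_some]

/-- One entry of the fast table from the tabulated data (row point `s`, row label `q`, tables of powers and popcounts). -/
def fastEntry3 (κ : ℕ → ℕ) (i t p : ℕ) (ptN : Fin t → ℕ) (ptabs : Array (Array ℕ)) (popQ : Array ℕ) (popB : Array ℕ)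
    (s q c : ℕ) : ℕ :=
  let B := windowStart i + c
  if q < i then fastAtt3 κ p (ptabs.getD s #[]) q (popQ.getD q 0) B (popB.getD c 0)
  else if hs : s < t then
    (if hq : q - i < t then fastPair κ p (ptN ⟨q - i, hq⟩) (ptN ⟨s, hs⟩) B else 0)
  else 0

/-- **The fast flat table, II** in the canonical window order: every per-point / per-row / per-column datum is computed ONCE
(power tables `powTab`, popcounts, row points and labels); an entry costs a handful of table reads. -/
def fastTable3 (κ : ℕ → ℕ) (i t n p : ℕ) (ptN : Fin t → ℕ) (h : blockWidth i t = n) : Array ℕ :=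
  let m := windowStart (i + t)
  let ptabs : Array (Array ℕ) := Array.ofFn fun s : Fin t => powTab (ptN s) p m
  let popQ : Array ℕ := Array.ofFn fun q : Fin i => popcount q.val
  let popB : Array ℕ := Array.ofFn fun c : Fin n => popcount (windowStart i + c.val)
  let rs := rowPoint i t n h
  let rq := rowLabel i t n h
  Array.ofFn fun idx : Fin (n * n) =>
    fastEntry3 κ i t p ptN ptabs popQ popB (rs.getD (idx.val / n) 0) (rq.getD (idx.val / n) 0) (idx.val % n)

/-- KERNEL: reading the fast table. -/
theorem fastTable3_getD (κ : ℕ → ℕ) (i t n p : ℕ) (ptN : Fin t → ℕ) (h : blockWidth i t = n) (r c : Fin n) :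
    (fastTable3 κ i t n p ptN h).getD (n * r.val + c.val) 0 =
      fastEntry3 κ i t p ptN (Array.ofFn fun s : Fin t => powTab (ptN s) p (windowStart (i + t)))
        (Array.ofFn fun q : Fin i => popcount q.val) (Array.ofFn fun c : Fin n => popcount (windowStart i + c.val))
        (((canonEquiv i t n h).symm r).1 : ℕ) (((canonEquiv i t n h).symm r).2 : ℕ) c.val := by
  have hn : 0 < n := Fin.pos r
  have hlt : n * r.val + c.val < n * n := by
    have := r.2; have := c.2; nlinarith
  rw [fastTable3, Array.getD_eq_getD_getElem?, Array.getElem?_ofFn, dif_pos hlt, Option.getD_some]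
  have e1 : (n * r.val + c.val) / n = r.val := by
    rw [Nat.mul_add_div hn, Nat.div_eq_of_lt c.2, Nat.add_zero]
  have e2 : (n * r.val + c.val) % n = c.val := by
    rw [Nat.mul_add_mod, Nat.mod_eq_of_lt c.2]
  simp only [e1, e2, rowPoint_getD, rowLabel_getD]

/-- **KERNEL: the fast table, II, IS the reindexed block matrix** (canonical order; over `ZMod p`, `p` prime). -/
theorem flatMat_fastTable3 (κ : ℕ → ℕ) (i t n p : ℕ) [Fact p.Prime] (ptN : Fin t → ℕ) (h : blockWidth i t = n) :
    flatMat p (fastTable3 κ i t n p ptN h) n =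
      Matrix.reindex (canonEquiv i t n h) (canonEquiv i t n h) (blockMatrix κ i t (fun s : Fin t => (ptN s : ZMod p))) := by
  ext r c
  rw [flatMat, fastTable3_getD, fastEntry3, Matrix.reindex_apply, Matrix.submatrix_apply, blockMatrix, Matrix.of_apply,
    blockEntry, finSigmaFinEquiv_canonEquiv_symm]
  set ρ := (canonEquiv i t n h).symm r with hρ
  have hs : (ρ.1 : ℕ) < t := ρ.1.2
  have hq2 : (ρ.2 : ℕ) < i + (ρ.1 : ℕ) := ρ.2.2
  by_cases hq : (ρ.2 : ℕ) < i
  · rw [if_pos hq, if_pos hq]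
    have hptab : (Array.ofFn fun s : Fin t => powTab (ptN s) p (windowStart (i + t))).getD (ρ.1 : ℕ) #[] =
        powTab (ptN ρ.1) p (windowStart (i + t)) := by
      rw [Array.getD_eq_getD_getElem?, Array.getElem?_ofFn, dif_pos hs, Option.getD_some]
    have hpopQ : (Array.ofFn fun q : Fin i => popcount q.val).getD (ρ.2 : ℕ) 0 = popcount (ρ.2 : ℕ) := by
      rw [Array.getD_eq_getD_getElem?, Array.getElem?_ofFn, dif_pos hq, Option.getD_some]
    have hpopB : (Array.ofFn fun c' : Fin n => popcount (windowStart i + c'.val)).getD c.val 0 =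
        popcount (windowStart i + c.val) := by
      rw [Array.getD_eq_getD_getElem?, Array.getElem?_ofFn, dif_pos c.2, Option.getD_some]
    rw [hptab, hpopQ, hpopB, natCast_fastAtt3 κ p _ _ _ _ ?_]
    have := finSigmaFinEquiv_canonEquiv_symm i t n h c
    have hlt := windowStart_add_finSigmaFinEquiv_lt i t ((canonEquiv i t n h).symm c)
    omega
  · rw [if_neg hq, if_neg hq, dif_pos hs, dif_pos (by omega), natCast_fastPair p κ]

/-- **From the fast table, II, and a checked packed certificate to the symbolic block determinant.** -/
theorem det_blockMatrix_X_ne_zero_of_packCheckP3 (κ : ℕ → ℕ) (i t n p : ℕ) [Fact p.Prime] (ptN : Fin t → ℕ)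
    (h : blockWidth i t = n) (lu perm pinv : Array ℕ) (hB : n * (p * p) < packBase)
    (hc : packCheckP (fastTable3 κ i t n p ptN h) lu perm n p = true) (hperm : lupPermCheck perm pinv n = true) :
    (blockMatrix κ i t (fun s : Fin t => (MvPolynomial.X s : MvPolynomial (Fin t) ℤ))).det ≠ 0 := by
  refine det_blockMatrix_X_ne_zero_of_point κ i t (fun s : Fin t => (ptN s : ZMod p)) ?_
  have := det_ne_zero_of_packCheckP n _ _ lu perm pinv (flatMat_fastTable3 κ i t n p ptN h) hB hc hperm
  rwa [Matrix.det_reindex_self] at this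

end Summit.ValiantsHypothesis.ValiantsHypothesis.Theorems.BarrierLever.MoorePeel
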